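import Summits.BirchSwinnertonDyer.BirchSwinnertonDyer.Theorems.SemiOrdinaryEisensteinDescentWildKolyvaginUpperAtThreeTowerFreeJetchevMaxModThree
import Summits.BirchSwinnertonDyer.BirchSwinnertonDyer.Theorems.SchneiderFreeAdditiveX3PoitouTateUnramifiedOrthogonalAllLevels
import Literature.NumberTheory.GaloisCohomology.LocalInvariantMapConjCompatible
import HarnessLib

/-!
# Route `SemiOrdinaryEisensteinDescent` rev 18, tree-debt item `JetchevMaxDivisibilityAtThreeModThree`
# (stmt-BirchSwinnertonDyer-25897): its DUALITY input reduced to the ONE printed statement the tree has not proved —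
# Milne *ADT* I Thm. 4.10(b) `Ker γ¹ ⊆ Im β¹` for THE canonical local invariant maps (width seat `bsd-wall-soed-p2-w2` g6;
# `--supports stmt-BirchSwinnertonDyer-25897`, helper)

WHY. The item is typed `PoitouTateSelmerStructureDualityFact → GrossHeegnerPointE0Input → GrossProp372FrobeniusCongruenceInput →
hJmax` with the FOUR-conjunct abstract fact `∀ K, poitouTate_selmerStructure_duality K` (∃ a family `inv` with IsPerfect ∧
SumLocalTermEqZero ∧ UnramifiedOrthogonal ∧ SelmerComplement), while the tree's proof of `hJmax` (`jetchevMaxModThree_of_literature`,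
p606426, Jetchev's Thm. 5.1 sign by sign) needs the FIVE-conjunct `poitouTate_selmerStructure_duality_conj` (+ `IsConjCompatible`; since act G″ rev 19 the kernel takes it BY NAME as item 23092 through the glue 26257);
p608444 closed the item modulo the five-conjunct fact and modulo {UnramifiedOrthogonal, SelmerComplement} of the canonical family.
Two tree theorems of other cells shrink that further:
* Milne I Thm. 2.6 `UnramifiedOrthogonal` holds for EVERY perfect family at EVERY level (cell bsd-schneider door-c4,
  `PoitouTateReduction.unramifiedOrthogonal_of_isPerfect_allLevels`), in particular for `LocalInvariants.canonical K n`
  (`LocalInvariants.canonical_isPerfect`) — so the `hUO` binder of p608444's `…_of_canonical` is a KERNEL THEOREM;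
* Howard's complement property `SelmerComplement` of the canonical family at every level follows from Milne I Thm. 4.10(b)
  `Ker γ¹ ⊆ Im β¹` («basic middle exactness», `hE`) for THE canonical maps ALONE (door-c6/door-c4,
  `PoitouTateReduction.selmerComplement_canonical_of_middleExact_allLevels`).
WHAT (conditional theorems; no definition, no named fact, no `sorry`):
* (Milne I 2.6 for THE maps in the `∀ K n` shape is bsd-stepL's `Rank1Residual.X11b.Three.Koly.unramifiedOrthogonal_canonical`
  (ClassRecordThree cone); here the term `unramifiedOrthogonal_of_isPerfect_allLevels _ canonical_isPerfect` is used inline);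
* `poitouTate_conj_forall_of_middleExact_canonical` — `(∀ K n, hE (canonical K n)) → ∀ K, poitouTate_selmerStructure_duality_conj K`;
* `jetchevMaxDivisibilityAtThreeModThree_of_selmerComplementCanonical` — **item 25897 ⟸ `∀ K n, (canonical K n).SelmerComplement`**;
* `jetchevMaxDivisibilityAtThreeModThree_of_middleExactCanonical` — **item 25897 ⟸ `∀ K n, hE (canonical K n)`**.
So the duality input of the whole SOED Kolyvagin column (items 25897 Jmax, 25898 J‴, aside Ko′ 24696) is EXACTLY ONE printed
statement, Milne I Thm. 4.10(b) (r = 1, `Ker ⊆ Im`) for THE invariant maps; IsPerfect (local Tate duality), the reciprocity law,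
Milne I Thm. 2.6 and the conjugation compatibility are kernel theorems. NOT proved here: `hE` (class-formation half of Tate's
theorem — cells bsd-schneider / bsd-stepL own its dévissage), E0, 3.7 (2). The item AS TYPED (abstract four-conjunct antecedent)
is NOT closed by this file either: from SOME family with the four properties one cannot presently derive the conjugation-compatible
one (a rigidity statement «every IsPerfect + reciprocity family is a constant unit multiple of the canonical one», which needs
global classes with prescribed local invariants at two places — Grunwald–Wang / Hasse norm — not in the tree); see the crux memo
`Cruxes/WildKolyvaginUpperAtThree/PT-INPUT-w2g6.md` (kernel frame of the rigidity statement: `Literature/NumberTheory/GaloisCohomology/LocalInvariantsRigidityCriterion.lean`, p611756). BSD is not proved by any of this.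

References: [cite: MilneADT2006, Ch. I, Cor. 2.3, Thm. 2.6, Thm. 4.10(b)] [cite: Howard2004HeegnerKolyvagin, Thm. 2.1.11 (arXiv:1202.6340 p. 6)]
[cite: CasselsFrohlichANT1967, Ch. VII §11] [cite: Neukirch2013, Ch. III §6] [cite: Jetchev2008, Thm. 1.4, Thm. 5.1].
-/

set_option autoImplicit false
set_option linter.dupNamespace false -- `Summit.BirchSwinnertonDyer.BirchSwinnertonDyer.…` is the tree's layout (D-0017)

noncomputable section

open NumberField IsDedekindDomain

namespace Summit.BirchSwinnertonDyer.BirchSwinnertonDyer.Theorems.JetchevMaxDivisibilityAtThreeModThreeOfMiddleExact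

open Literature.NumberTheory.GaloisRepresentations Literature.NumberTheory.GaloisCohomology
open Literature.NumberTheory.GaloisRepresentations.DiscreteGaloisModule (localTatePairingZMod unramifiedSubgroup)
open Summit.BirchSwinnertonDyer.BirchSwinnertonDyer.Theses.SemiOrdinaryEisensteinDescent
open Summit.BirchSwinnertonDyer.BirchSwinnertonDyer.Theorems.SchneiderFreeAdditiveX3.PoitouTateReduction
  (unramifiedOrthogonal_of_isPerfect_allLevels selmerComplement_canonical_of_middleExact_allLevels)

/-! ## §1 The five-conjunct fact at every number field ⟸ `hE` (Milne I 2.6, IsPerfect, reciprocity, conjugation compatibility being kernel theorems) -/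

/-- **The five-conjunct Poitou–Tate fact for Selmer structures (`poitouTate_selmerStructure_duality_conj`, every number field) from
ONE printed statement**: Milne *ADT* I Thm. 4.10(b), `r = 1`, inclusion `Ker γ¹ ⊆ Im β¹`, for THE canonical maps
`LocalInvariants.canonical K n`, at every `K : Type` and every level `n ≥ 1` — for every finite discrete `Γ_K`-module `M` killed by
`n`, every finite `S ⊇ {v ∣ ∞}` off which `v ∤ n` and `M` is unramified, and every `t ∈ Π_v H¹(K_v, M)` with
`∑_{v∈S} inv_v (t_v ∪ loc_v y) = 0` for all `y ∈ H¹(K, M^D)` unramified outside `S`, some `x ∈ H¹(K, M)` unramified outside `S` has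
`loc_v x = t_v` on `S`. The other four conjuncts are kernel theorems: `canonical_isPerfect`, the reciprocity law
(`sumInvLocalizationEqZero_canonical_of_numberField`), Milne I 2.6 (§1) and `isConjCompatible_canonical`; composed through
`poitouTate_selmerStructure_duality_conj_of_canonical_numberField` and `selmerComplement_canonical_of_middleExact_allLevels`.
CONDITIONAL on `hE`. [cite: MilneADT2006, Ch. I, Thm. 4.10(b)] [cite: Howard2004HeegnerKolyvagin, Thm. 2.1.11 (arXiv:1202.6340 p. 6)]
[cite: Neukirch2013, Ch. III §6] -/
theorem poitouTate_conj_forall_of_middleExact_canonical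
    (hE : ∀ (K : Type) [Field K] [NumberField K] (n : ℕ) [NeZero n],
      ∀ ⦃M : Type⦄ [AddCommGroup M] [TopologicalSpace M] [DiscreteTopology M] [Finite M]
      (ρ : DiscreteGaloisModule K M), (∀ m : M, n • m = 0) →
      ∀ S : Finset (Place K), (∀ w : InfinitePlace K, (Sum.inl w : Place K) ∈ S) →
        (∀ v : HeightOneSpectrum (𝓞 K), (Sum.inr v : Place K) ∉ S →
          ((n : ℕ) : 𝓞 K) ∉ v.asIdeal ∧ GaloisRep.IsUnramifiedAt v ρ) →
        ∀ t : Π v : Place K, galoisCohomology (ρ.toLocal v) 1,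
          (∀ y : galoisCohomology (ρ.tateDual n) 1,
            (∀ v : HeightOneSpectrum (𝓞 K), (Sum.inr v : Place K) ∉ S →
              galoisCohomology.localization (ρ.tateDual n) (Sum.inr v) 1 y ∈
                unramifiedSubgroup (GaloisRep.toLocal v (ρ.tateDual n)) 1) →
            ∑ v ∈ S, localTatePairingZMod ρ n v (LocalInvariants.canonical K n v) (t v)
              (galoisCohomology.localization (ρ.tateDual n) v 1 y) = 0) →
          ∃ x : galoisCohomology ρ 1,
            (∀ v : HeightOneSpectrum (𝓞 K), (Sum.inr v : Place K) ∉ S →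
              galoisCohomology.localization ρ (Sum.inr v) 1 x ∈
                unramifiedSubgroup (GaloisRep.toLocal v ρ) 1) ∧
            ∀ v ∈ S, galoisCohomology.localization ρ v 1 x = t v) :
    ∀ (K : Type) [Field K] [NumberField K], poitouTate_selmerStructure_duality_conj K :=
  fun K _ _ ↦ poitouTate_selmerStructure_duality_conj_of_canonical_numberField K
    (fun n _ ↦ unramifiedOrthogonal_of_isPerfect_allLevels (LocalInvariants.canonical K n)
      LocalInvariants.canonical_isPerfect)
    (fun n _ ↦ selmerComplement_canonical_of_middleExact_allLevels n (hE K n))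

/-! ## §2 Item 25897 from `SelmerComplement` of the canonical family alone, and from `hE` alone -/

/-- **Item `JetchevMaxDivisibilityAtThreeModThree` (25897) ⟸ Howard's complement property of THE canonical family at every number
field and level** (`SelmerComplement`: Milne I Thm. 4.10(b) `⊇` / Howard 2004 Thm. 2.1.11) — p608444's `…_of_canonical` with its
`UnramifiedOrthogonal` binder DISCHARGED (door-c4's `unramifiedOrthogonal_of_isPerfect_allLevels` at `canonical_isPerfect`; the `∀ K` Poitou–Tate
step is bsd-stepL's `Koly.poitouTate_conj_forall_of_selmerComplement_canonical`, re-spelled inline to stay off the ClassRecordThree cone), then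
`jetchevMaxModThree_of_literature` (p606426). CONDITIONAL on `hSC`; the item's own antecedents E0 and 3.7 (2) are consumed as typed, its PT⁴
antecedent is not used.
[cite: MilneADT2006, Ch. I, Thm. 4.10(b)] [cite: Howard2004HeegnerKolyvagin, Thm. 2.1.11 (arXiv:1202.6340 p. 6)]
[cite: Jetchev2008, Thm. 1.4 (p. 812)] -/
theorem jetchevMaxDivisibilityAtThreeModThree_of_selmerComplementCanonical
    (hSC : ∀ (K : Type) [Field K] [NumberField K] (n : ℕ) [NeZero n],
      (LocalInvariants.canonical K n).SelmerComplement) :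
    JetchevMaxDivisibilityAtThreeModThree := by
  intro _ hE0 h372
  exact WildKolyvaginUpperAtThreeTowerFreeJetchevMaxModThree.jetchevMaxModThree_of_literature
    (fun K _ _ ↦ poitouTate_selmerStructure_duality_conj_of_canonical_numberField K
      (fun n _ ↦ unramifiedOrthogonal_of_isPerfect_allLevels (LocalInvariants.canonical K n)
        LocalInvariants.canonical_isPerfect) (hSC K))
    hE0 h372

/-- **Item `JetchevMaxDivisibilityAtThreeModThree` (25897) ⟸ ONE printed statement — Milne *ADT* I Thm. 4.10(b) `Ker γ¹ ⊆ Im β¹`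
(`r = 1`) for THE canonical local invariant maps, at every number field `K : Type` and every level `n ≥ 1`** (hypothesis `hE`, spelled
as in `PoitouTateReduction.selmerComplement_canonical_of_middleExact_allLevels`). Every other duality ingredient of Jetchev's
max-form at `3 ∣ N` under `ρ̄₃` onto (local Tate duality, reciprocity, Milne I 2.6, conjugation compatibility) is a kernel theorem.
CONDITIONAL on `hE`; E0 and 3.7 (2) are the item's own antecedents. BSD is not proved by this.
[cite: MilneADT2006, Ch. I, Thm. 4.10(b)] [cite: Jetchev2008, Thm. 1.4 (p. 812), Thm. 5.1] [cite: CasselsFrohlichANT1967, Ch. VII §11] -/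
theorem jetchevMaxDivisibilityAtThreeModThree_of_middleExactCanonical
    (hE : ∀ (K : Type) [Field K] [NumberField K] (n : ℕ) [NeZero n],
      ∀ ⦃M : Type⦄ [AddCommGroup M] [TopologicalSpace M] [DiscreteTopology M] [Finite M]
      (ρ : DiscreteGaloisModule K M), (∀ m : M, n • m = 0) →
      ∀ S : Finset (Place K), (∀ w : InfinitePlace K, (Sum.inl w : Place K) ∈ S) →
        (∀ v : HeightOneSpectrum (𝓞 K), (Sum.inr v : Place K) ∉ S →
          ((n : ℕ) : 𝓞 K) ∉ v.asIdeal ∧ GaloisRep.IsUnramifiedAt v ρ) →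
        ∀ t : Π v : Place K, galoisCohomology (ρ.toLocal v) 1,
          (∀ y : galoisCohomology (ρ.tateDual n) 1,
            (∀ v : HeightOneSpectrum (𝓞 K), (Sum.inr v : Place K) ∉ S →
              galoisCohomology.localization (ρ.tateDual n) (Sum.inr v) 1 y ∈
                unramifiedSubgroup (GaloisRep.toLocal v (ρ.tateDual n)) 1) →
            ∑ v ∈ S, localTatePairingZMod ρ n v (LocalInvariants.canonical K n v) (t v)
              (galoisCohomology.localization (ρ.tateDual n) v 1 y) = 0) →
          ∃ x : galoisCohomology ρ 1,
            (∀ v : HeightOneSpectrum (𝓞 K), (Sum.inr v : Place K) ∉ S →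
              galoisCohomology.localization ρ (Sum.inr v) 1 x ∈
                unramifiedSubgroup (GaloisRep.toLocal v ρ) 1) ∧
            ∀ v ∈ S, galoisCohomology.localization ρ v 1 x = t v) :
    JetchevMaxDivisibilityAtThreeModThree := by
  intro _ hE0 h372
  exact WildKolyvaginUpperAtThreeTowerFreeJetchevMaxModThree.jetchevMaxModThree_of_literature
    (poitouTate_conj_forall_of_middleExact_canonical hE) hE0 h372

end Summit.BirchSwinnertonDyer.BirchSwinnertonDyer.Theorems.JetchevMaxDivisibilityAtThreeModThreeOfMiddleExact

end
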